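import Summits.ABC.IUTFork.LDHGenuinePerImageSufficiencyPoint
import Summits.ABC.IUTFork.ForkGenuineWindowSharpCond
import HarnessLib

/-!
# The fork at [IUTchIII] Corollary 3.12, L-DH level, READING (P): the sufficient half at a Θ-datum SHARPENED by the
# ramification of `K` over places OUTSIDE `𝕍^bad_mod` (e.g. over `l`: `μ_l ⊆ K = F(E_F[l])` forces `e ≥ l − 1`)
# (abc-iut cell, crux ThetaPartII = stmt-ABC-19678, stub `stub_cor312PerImage`; task «C:PERIMAGE-1061-13»)

Record-only PROOF file (D-0012) of the abc-iut cell (WAVE-3 discharge seat abc-iut-c312-d1, gen 8). TAKES NO SIDE on [IUTchIII]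
Cor. 3.12. Part B (`LDHGenuinePerImageSufficiencyPoint`, p446147) proved, at every genuine Θ-volume datum `T` of `(P, l)`:
`κ_l·log q^{∤2l}(λ) ≤ ((l+5)/4 − d_mod)·log(𝔡^K) + ((l+5)/4)·log π ⟹ T.Cor312PerImageOf` (`GenuineContent.cor312PerImageOf_of_le_mul_ndeg`)
and fed it abc-iut-S4's Step (ii) lower bound `log(𝔡^K) ≥ log-diff(λ) + (1 − 1/l)·log 𝔣^{∤2l}(λ)` (`ndeg_differentDivisor_ge`, from
`l ∣ e(w∣v)` at the bad places `v ∤ 2l`). That bound IGNORES every place of `K` outside `𝕍^bad_mod` — in particular the places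
over `l`, where `K ⊇ F(E_F[l]) ⊇ ℚ(ζ_l)` (Weil pairing) is ramified with index `≥ l − 1`. HERE the lower bound and the sufficient
condition are sharpened by an arbitrary finite set `Sₓ` of places of `F_tpd` disjoint from `𝕍^bad_mod`, over which every place of
`K` has ramification index `≥ m`:

* **`Cor22.ThetaVolumeDatumAt.ndeg_differentDivisor_ge_of_ramified`** —
  `log(𝔡^K) ≥ log-diff(λ) + (1 − 1/l)·log 𝔣^{∤2l}(λ) + (1 − 1/m)·(1/[F_tpd:ℚ])·Σ_{v ∈ Sₓ} log N(v)`
  ([GenEll] Prop. 1.7 (i) `cond_sub_cond_le_logdisc_sub_logdisc` for `S = 𝕍^bad_mod ∪ Sₓ`, abc-iut-S4's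
  `cond_above_le_cond_div_of_le_ramificationIdx` on both parts);
* **`Cor22.ThetaVolumeDatumAt.cor312PerImageOf_of_le_logDiff_logCond_ramified`** — for `λ ∈ U_X`, `l ≥ 1`, `d_mod ≤ (l+5)/4`:
  `κ_l·log q^{∤2l} ≤ ((l+5)/4 − d_mod)·(log-diff + (1 − 1/l)·log 𝔣^{∤2l} + (1 − 1/m)·(1/[F_tpd:ℚ])·Σ_{v∈Sₓ} log N(v)) + ((l+5)/4)·log π
  ⟹ T.Cor312PerImageOf` (`κ_l = (l+1)/24 − 1/(2l)`).

READING (task «C:PERIMAGE-1061-13», abc-iut-plan 2026-08-26T19:36:51Z; numbers about OUR typed objects): at the Frey datum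
(λ_1061, l = 13) of `3³241³ + 5⁸11⁹19·61³ = 2¹⁵17²331·1061⁴` the plain bound falls short by 1.72 nats of the 32.41 needed; with
`Sₓ = {13}` and `m = 12` (every place of `K` over `13` has `e ≥ 12`, which follows from `μ_13 ⊆ K` — GAP-LEDGER row G-c312d1g8-1,
[Silverman AEC III Cor. 8.1.1], not in the tree — and Mathlib's ramification of `13` in `ℚ(ζ_13)`) the bound becomes 33.04 and the
per-image Corollary holds at every genuine `T` of that datum. The hypothesis `hram` is EXPLICIT here; nothing is assumed silently.
Nothing here asserts the existence of data, Cor. 3.12 in general, or abc; proved-as-typed ≠ in print. [cite: Mochizuki2012, IUTchIII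
Cor. 3.12 p. 173–174; IUTchIV Thm. 1.10 Step (ii) p. 24, Step (v) p. 27–29, Step (vii) p. 30] [cite: MochizukiGenEll2010, Prop. 1.7 (i) p. 9–10]
[claim: Mochizuki2012, status: disputed] for every IUT quotation. PROOF-ONLY: no definitions, no new `Prop`.
-/

noncomputable section

open NumberField IsDedekindDomain Ideal Module

namespace Literature.IUT.LogVolume.Cor22

open Literature.NumberTheory.DiophantineGeometry.GenEll Summit.ABC.IUTFork Literature.IUT.HodgeTheaters

namespace ThetaVolumeDatumAt

variable {P : NFPoint} {l : ℕ} (T : ThetaVolumeDatumAt P l)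

/-- **STEP (ii) LOWER BOUND, SHARPENED BY EXTRA RAMIFIED PLACES**: for a finite set `Sₓ` of places of `F_tpd` disjoint from
`𝕍^bad_mod` (the poles of `j(λ)` away from `2l`) over which every place of the datum's `K` has ramification index `≥ m ≥ 1`:
`log(𝔡^K) ≥ log-diff(λ) + (1 − 1/l)·log 𝔣^{∤2l}(λ) + (1 − 1/m)·(1/[F_tpd:ℚ])·Σ_{v∈Sₓ} log N(v)`.
[cite: MochizukiGenEll2010, Prop. 1.7 (i) p. 9–10] [cite: Mochizuki2012, IUTchIV Thm. 1.10 Step (ii) p. 24] [claim: Mochizuki2012, status: disputed] -/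
theorem ndeg_differentDivisor_ge_of_ramified (hl : 0 < l) (Sx : Finset (HeightOneSpectrum (𝓞 P.F)))
    (hdisj : Disjoint (badPlacesAvoid P {2, l}) Sx) {m : ℕ} (hm : 0 < m)
    (hram : letI := T.instFieldF; letI := T.instNumberFieldF; letI := T.instAlgebraF; letI := T.instFieldK
      letI := T.instNumberFieldK; letI := T.instAlgebraK
      letI : Algebra P.F T.K := ((algebraMap T.F T.K).comp (algebraMap P.F T.F)).toAlgebra
      ∀ v ∈ Sx, ∀ w ∈ IsDedekindDomain.primesOverFinset v.asIdeal (𝓞 T.K), m ≤ ramificationIdx' v.asIdeal w) :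
    (letI := T.instFieldK; letI := T.instNumberFieldK
     P.logDiff + (1 - 1 / (l : ℝ)) * logCondAvoid P {2, l}
        + (1 - (m : ℝ)⁻¹) * ((P.degree : ℝ)⁻¹ * ∑ v ∈ Sx, Real.log (absNorm v.asIdeal : ℝ))
      ≤ ndeg T.K (differentDivisor T.K)) := by
  classical
  letI := T.instFieldF; letI := T.instNumberFieldF; letI := T.instAlgebraF; letI := T.instFieldK
  letI := T.instNumberFieldK; letI := T.instAlgebraK
  letI : Algebra P.F T.K := ((algebraMap T.F T.K).comp (algebraMap P.F T.F)).toAlgebra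
  -- the places of `K` over `Sₓ`
  set Tx : Finset (HeightOneSpectrum (𝓞 T.K)) := Sx.biUnion fun v =>
    (IsDedekindDomain.primesOverFinset v.asIdeal (𝓞 T.K)).preimage HeightOneSpectrum.asIdeal
      (fun _ _ _ _ h => HeightOneSpectrum.ext h) with hTx
  have hmemTx : ∀ w : HeightOneSpectrum (𝓞 T.K), w.under (𝓞 P.F) ∈ Sx → w ∈ Tx := by
    intro w hw
    rw [hTx, Finset.mem_biUnion]
    refine ⟨w.under (𝓞 P.F), hw, ?_⟩
    rw [Finset.mem_preimage, IsDedekindDomain.mem_primesOverFinset_iff (w.under (𝓞 P.F)).ne_bot]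
    exact ⟨w.isPrime, ⟨rfl⟩⟩
  -- [GenEll] Prop. 1.7 (i) with `S = 𝕍^bad ∪ Sₓ`, `T = 𝕍(K)^bad ∪ Tₓ`
  have hT : ∀ w : HeightOneSpectrum (𝓞 T.K), w.under (𝓞 P.F) ∈ badPlacesAvoid P {2, l} ∪ Sx →
      w ∈ badPlacesOver P {2, l} T.K ∪ Tx := by
    intro w hw
    rcases Finset.mem_union.1 hw with h | h
    · exact Finset.mem_union.2 (Or.inl ((mem_badPlacesOver_iff w).mpr h))
    · exact Finset.mem_union.2 (Or.inr (hmemTx w h))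
  have hmain := cond_sub_cond_le_logdisc_sub_logdisc P.F T.K (badPlacesAvoid P {2, l} ∪ Sx)
    (badPlacesOver P {2, l} T.K ∪ Tx) hT
  rw [Finset.sum_union hdisj] at hmain
  -- the two halves of `T`
  have hlog0 : ∀ w : HeightOneSpectrum (𝓞 T.K), 0 ≤ Real.log (absNorm w.asIdeal : ℝ) := fun w => by
    have h1 : (1 : ℝ) ≤ (absNorm w.asIdeal : ℕ) := by
      exact_mod_cast Nat.one_le_iff_ne_zero.mpr (by rw [Ne, Ideal.absNorm_eq_zero_iff]; exact w.ne_bot)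
    exact Real.log_nonneg h1
  have hsplit : ∑ w ∈ badPlacesOver P {2, l} T.K ∪ Tx, Real.log (absNorm w.asIdeal : ℝ) ≤
      ∑ w ∈ badPlacesOver P {2, l} T.K, Real.log (absNorm w.asIdeal : ℝ)
        + ∑ w ∈ Tx, Real.log (absNorm w.asIdeal : ℝ) := by
    rw [← Finset.sum_union_inter]
    have : 0 ≤ ∑ w ∈ badPlacesOver P {2, l} T.K ∩ Tx, Real.log (absNorm w.asIdeal : ℝ) :=
      Finset.sum_nonneg fun w _ => hlog0 w
    linarith
  -- `(1/[K:ℚ])·Σ_{𝕍(K)^bad} log N(w) = log 𝔣^K ≤ (1/l)·log 𝔣^{F_tpd}` (abc-iut-S4)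
  have hbad : (finrank ℚ T.K : ℝ)⁻¹ * ∑ w ∈ badPlacesOver P {2, l} T.K, Real.log (absNorm w.asIdeal : ℝ) ≤
      (l : ℝ)⁻¹ * logCondAvoid P {2, l} :=
    logCondOver_le_div_of_le_ramificationIdx P {2, l} T.K hl T.l_le_ramificationIdx_of_mem_badPlacesAvoid
  -- `(1/[K:ℚ])·Σ_{Tₓ} log N(w) ≤ (1/m)·(1/[F_tpd:ℚ])·Σ_{Sₓ} log N(v)`
  have hx : (finrank ℚ T.K : ℝ)⁻¹ * ∑ w ∈ Tx, Real.log (absNorm w.asIdeal : ℝ) ≤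
      (m : ℝ)⁻¹ * ((finrank ℚ P.F : ℝ)⁻¹ * ∑ v ∈ Sx, Real.log (absNorm v.asIdeal : ℝ)) := by
    have h := cond_above_le_cond_div_of_le_ramificationIdx P.F T.K Sx hm hram
    refine le_trans (le_of_eq ?_) h
    congr 1
    rw [hTx, Finset.sum_biUnion]
    · refine Finset.sum_congr rfl fun v _ => ?_
      refine Finset.sum_preimage HeightOneSpectrum.asIdeal _ _
        (fun w : Ideal (𝓞 T.K) => Real.log (absNorm w : ℝ)) ?_
      intro w hw hnot
      exfalso
      rw [IsDedekindDomain.mem_primesOverFinset_iff v.ne_bot] at hw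
      exact hnot ⟨⟨w, hw.1, Ideal.ne_bot_of_mem_primesOver v.ne_bot hw⟩, rfl⟩
    · intro v _ v' _ hne
      refine Finset.disjoint_left.mpr fun w hw hw' => hne ?_
      dsimp only at hw hw'
      rw [Finset.mem_preimage, IsDedekindDomain.mem_primesOverFinset_iff v.ne_bot] at hw
      rw [Finset.mem_preimage, IsDedekindDomain.mem_primesOverFinset_iff v'.ne_bot] at hw'
      exact HeightOneSpectrum.ext (hw.2.over.trans hw'.2.over.symm)
  -- dictionary of the remaining terms
  have hcond : logCondAvoid P {2, l} = (P.degree : ℝ)⁻¹ * ∑ v ∈ badPlacesAvoid P {2, l},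
      Real.log (absNorm v.asIdeal : ℝ) := logCondAvoid_eq_sum P {2, l}
  have hdP : P.logDiff = (P.degree : ℝ)⁻¹ * Real.log ((discr P.F).natAbs : ℝ) := NFPoint.logDiff_eq_log_discr P
  have hdK : ndeg T.K (differentDivisor T.K) = (finrank ℚ T.K : ℝ)⁻¹ * Real.log ((discr T.K).natAbs : ℝ) := by
    have h1 := logDiff_eq_ndeg_differentDivisor (extend P T.K)
    have h2 := NFPoint.logDiff_eq_log_discr (extend P T.K)
    rw [h1] at h2
    exact h2
  have hdeg : (P.degree : ℝ) = (finrank ℚ P.F : ℝ) := rfl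
  have hK0 : 0 ≤ (finrank ℚ T.K : ℝ)⁻¹ := inv_nonneg.mpr (Nat.cast_nonneg _)
  have hsplit' := mul_le_mul_of_nonneg_left hsplit hK0
  have hl1 : (l : ℝ)⁻¹ = 1 / (l : ℝ) := (one_div _).symm
  rw [hl1] at hbad
  rw [hcond, hdP, hdK, hdeg]
  rw [hdeg] at hcond
  rw [hcond] at hbad
  linarith [hmain, hsplit', hbad, hx]

/-- **THE SHARPENED SUFFICIENT HALF OF THE (P)-LINE CRUX AT A DATUM**: `λ ∈ U_X`, `l ≥ 1`, `d_mod ≤ (l+5)/4`, `Sₓ` a finite set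
of places of `F_tpd` disjoint from `𝕍^bad_mod` over which every place of `K` has ramification index `≥ m ≥ 1`; if
`((l+1)/24 − 1/(2l))·log q^{∤2l}(λ) ≤ ((l+5)/4 − d_mod)·(log-diff(λ) + (1 − 1/l)·log 𝔣^{∤2l}(λ) + (1 − 1/m)·(1/[F_tpd:ℚ])·Σ_{v∈Sₓ} log N(v))
+ ((l+5)/4)·log π` then [IUTchIII] Cor. 3.12 holds IN READING (P) at `T`. [cite: Mochizuki2012, IUTchIII Cor. 3.12 p. 173–174]
[cite: Mochizuki2012, IUTchIV Thm. 1.10 Step (ii) p. 24, Step (v) p. 27–29] [claim: Mochizuki2012, status: disputed] -/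
theorem cor312PerImageOf_of_le_logDiff_logCond_ramified (hU : P.InU) (hl : 0 < l)
    (hd : (dmod P : ℝ) ≤ ((l : ℝ) + 5) / 4) (Sx : Finset (HeightOneSpectrum (𝓞 P.F)))
    (hdisj : Disjoint (badPlacesAvoid P {2, l}) Sx) {m : ℕ} (hm : 0 < m)
    (hram : letI := T.instFieldF; letI := T.instNumberFieldF; letI := T.instAlgebraF; letI := T.instFieldK
      letI := T.instNumberFieldK; letI := T.instAlgebraK
      letI : Algebra P.F T.K := ((algebraMap T.F T.K).comp (algebraMap P.F T.F)).toAlgebra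
      ∀ v ∈ Sx, ∀ w ∈ IsDedekindDomain.primesOverFinset v.asIdeal (𝓞 T.K), m ≤ ramificationIdx' v.asIdeal w)
    (h : (((l : ℝ) + 1) / 24 - 1 / (2 * l)) * logQAvoid P {2, l} ≤
      (((l : ℝ) + 5) / 4 - dmod P) * (P.logDiff + (1 - 1 / (l : ℝ)) * logCondAvoid P {2, l}
          + (1 - (m : ℝ)⁻¹) * ((P.degree : ℝ)⁻¹ * ∑ v ∈ Sx, Real.log (absNorm v.asIdeal : ℝ)))
        + ThetaVolumeInput.archLogTheta l) :
    T.Cor312PerImageOf := by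
  letI := T.instFieldF; letI := T.instNumberFieldF; letI := T.instAlgebraF; letI := T.instFieldK
  letI := T.instNumberFieldK; letI := T.instAlgebraK; letI := T.instFieldFbar; letI := T.instAlgebraFbar
  letI := T.instAlgebraKFbar; letI := T.instIsElliptic
  haveI := T.isGalois_fieldOfModuli_K
  have hgap := PointDict.gap_eq T hU
  have hXlN : T.I.X.l = l := T.isVolumeInputOf.l_eq
  have hXl : ((T.I.X.l : ℕ) : ℝ) = (l : ℝ) := by exact_mod_cast hXlN
  have hls : ((T.I.X.lstar : ℝ) + 3) / 2 = ((l : ℝ) + 5) / 4 := by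
    have h2 : T.I.X.l = 2 * T.I.X.lstar + 1 := T.I.X.l_eq
    have h2R : ((T.I.X.l : ℕ) : ℝ) = 2 * (T.I.X.lstar : ℝ) + 1 := by exact_mod_cast h2
    rw [hXl] at h2R
    linarith
  have hdm : (Module.finrank ℚ (fieldOfModuli T.E) : ℝ) = (dmod P : ℝ) := by
    exact_mod_cast PointStepV.finrank_fieldOfModuli_eq_dmod T
  -- the sharpened Step (ii) bound at the datum
  have hdiff := T.ndeg_differentDivisor_ge_of_ramified hl Sx hdisj hm hram
  have hc : 0 ≤ ((l : ℝ) + 5) / 4 - (dmod P : ℝ) := by linarith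
  have hmono := mul_le_mul_of_nonneg_left hdiff hc
  show T.I.Cor312PerImageOf
  refine GenuineContent.cor312PerImageOf_of_le_mul_ndeg T.I ?_
  rw [hXl, hls, hdm]
  have hg : T.gap = (((l : ℝ) + 1) / 24 - 1 / (2 * l)) * FinDivisor.ndeg (fieldOfModuli T.E) T.I.X.qDivisor := by
    show LgpDivisor.ndegLgp T.I.X.thetaPilot - FinDivisor.ndeg _ T.I.X.qPilot = _
    rw [DHData.ndegLgp_thetaPilot_eq, PilotData.qPilot_eq_smul, map_smul, smul_eq_mul, hXl]
    ring
  rw [← hg, hgap]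
  show _ ≤ _ + ThetaVolumeInput.archLogTheta T.I.X.l
  rw [hXlN]
  change P.logDiff + (1 - 1 / (l : ℝ)) * logCondAvoid P {2, l}
      + (1 - (m : ℝ)⁻¹) * ((P.degree : ℝ)⁻¹ * ∑ v ∈ Sx, Real.log (absNorm v.asIdeal : ℝ))
    ≤ ndeg T.K (differentDivisor T.K) at hdiff
  linarith

end ThetaVolumeDatumAt

variable {P : NFPoint} {l : ℕ}

/-- **AT EVERY DATUM WITH THE GIVEN RAMIFICATION**: under the same hypotheses on `(P, l, Sₓ, m)`, the sharpened Szpiro-type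
inequality implies `T.Cor312PerImageOf` for every genuine Θ-volume datum `T` of `(P, l)` each of whose places over `Sₓ` has
ramification index `≥ m` over `F_tpd`. [cite: Mochizuki2012, IUTchIII Cor. 3.12 p. 173–174] [claim: Mochizuki2012, status: disputed] -/
theorem cor312PerImageOf_of_le_logDiff_logCond_ramified_all (hU : P.InU) (hl : 0 < l)
    (hd : (dmod P : ℝ) ≤ ((l : ℝ) + 5) / 4) (Sx : Finset (HeightOneSpectrum (𝓞 P.F)))
    (hdisj : Disjoint (badPlacesAvoid P {2, l}) Sx) {m : ℕ} (hm : 0 < m)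
    (h : (((l : ℝ) + 1) / 24 - 1 / (2 * l)) * logQAvoid P {2, l} ≤
      (((l : ℝ) + 5) / 4 - dmod P) * (P.logDiff + (1 - 1 / (l : ℝ)) * logCondAvoid P {2, l}
          + (1 - (m : ℝ)⁻¹) * ((P.degree : ℝ)⁻¹ * ∑ v ∈ Sx, Real.log (absNorm v.asIdeal : ℝ)))
        + ThetaVolumeInput.archLogTheta l) :
    ∀ T : ThetaVolumeDatumAt P l,
      (letI := T.instFieldF; letI := T.instNumberFieldF; letI := T.instAlgebraF; letI := T.instFieldK
       letI := T.instNumberFieldK; letI := T.instAlgebraK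
       letI : Algebra P.F T.K := ((algebraMap T.F T.K).comp (algebraMap P.F T.F)).toAlgebra
       ∀ v ∈ Sx, ∀ w ∈ IsDedekindDomain.primesOverFinset v.asIdeal (𝓞 T.K), m ≤ ramificationIdx' v.asIdeal w) →
      T.Cor312PerImageOf :=
  fun T hram => T.cor312PerImageOf_of_le_logDiff_logCond_ramified hU hl hd Sx hdisj hm hram h

end Literature.IUT.LogVolume.Cor22

end
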